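import Summits.BirchSwinnertonDyer.BirchSwinnertonDyer.Theorems.KolyvaginDepthDoorMSymbolCert446d1K
import HarnessLib

/-!
# Route `KolyvaginDepthDoor`, crux `KolyvaginDepthSupplyKN` (stmt-BirchSwinnertonDyer-22820) —
# DEPTH TABLE v28: the E-side Kurihara claim of the COMPOSITE-conductor row `446d1` @ `(7, 71·113)` is a KERNEL THEOREM

Helper file of the lead prover of line `levelone` (kdd-p1 g33; `--supports stmt-BirchSwinnertonDyer-22820 --as helper`); it
closes nothing and BSD is NOT proved by it. `C446d1.kuriharaClaim_7_8023` is the hypothesis `hδE` of the socket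
`C446d1.cruxBody_of_twistKuriharaClaim_7_neg23` VERBATIM (the claim of the tree record `cert_446d1` @ `(7, 8023)`, so far PARI output taken
on trust), proved by the kernel-certified plus M-symbol of `446d1` on the pair-indexed `ℙ¹(ℤ/446)` (`…MSymbolCert446d1[K]`, kit 1′–4′).

References: [Kim2022StructureSelmer] §1.4.3; [CremonaAlgorithms1997] §2.2–2.5, Table 1 (446d1).
-/

set_option linter.dupNamespace false

noncomputable section

open scoped Classical NumberField

namespace Summit.BirchSwinnertonDyer.BirchSwinnertonDyer.Theorems.KolyvaginDepthDoor

open Literature.NumberTheory.EllipticCurves Literature.NumberTheory.EllipticCurves.ModularForms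
  WeierstrassCurve NumberField IsDedekindDomain
open Summit.BirchSwinnertonDyer.BirchSwinnertonDyer.Theorems
open Summit.BirchSwinnertonDyer.BirchSwinnertonDyer.Rank2Observatory

namespace C446d1

/-- **THE E-SIDE KURIHARA CLAIM OF ROW `446d1` @ `(7, 71·113)` IS A THEOREM** — literally the hypothesis `hδE` of
`cruxBody_of_twistKuriharaClaim_7_neg23`. [cite: Kim2022StructureSelmer, §1.4.3] [cite: CremonaAlgorithms1997, §2.2–2.5] -/
theorem kuriharaClaim_7_8023 :
    haveI := isElliptic_c446d1; haveI := isGloballyMinimal_c446d1;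
      haveI : NeZero ((((⟨1, -1, 0, -4, 4⟩ : WeierstrassCurve ℤ).map (Int.castRingHom ℚ))).conductorNorm ℤ) := neZero_conductorNorm_of_isElliptic _;
      haveI := Fact.mk (by norm_num : Nat.Prime 7);
      ∀ (D : ModularParametrizationData (((⟨1, -1, 0, -4, 4⟩ : WeierstrassCurve ℤ).map (Int.castRingHom ℚ))) ((((⟨1, -1, 0, -4, 4⟩ : WeierstrassCurve ℤ).map (Int.castRingHom ℚ))).conductorNorm ℤ)), ¬ ((7 : ℕ) : ℤ) ∣ D.maninConstant →
        (∃ u : ℚ, ‖(u : ℚ_[7])‖ = 1 ∧ (((⟨1, -1, 0, -4, 4⟩ : WeierstrassCurve ℤ).map (Int.castRingHom ℚ))).realPeriodRat = u * plusPeriod D.f) →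
        ∃ ψ : (ℓ : ℕ) → (ZMod ℓ)ˣ →* Multiplicative (ZMod 7),
          (∀ ℓ ∈ (8023 : ℕ).primeFactors, Function.Surjective (ψ ℓ)) ∧ kuriharaNumber D.f 7 8023 ψ ≠ 0 := by
  intro D _ _
  haveI := isElliptic_c446d1
  haveI : NeZero ((((⟨1, -1, 0, -4, 4⟩ : WeierstrassCurve ℤ).map (Int.castRingHom ℚ))).conductorNorm ℤ) := neZero_conductorNorm_of_isElliptic _
  exact MSymbolCert.Cert446d1.exists_kuriharaNumber_ne_zero_446d1 _ (C446d1.conductorNorm_eq.trans (by norm_num)) D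

end C446d1

end Summit.BirchSwinnertonDyer.BirchSwinnertonDyer.Theorems.KolyvaginDepthDoor

end
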